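/-
Copyright (c) 2026. All rights reserved.
Released under Apache 2.0 license as described in the file LICENSE.
Authors: HodgeCM publication cell (pub-hodgecm), GR lane, seat GR-2 (`pub-hodgecm-own-hyp34`).
-/
import Literature.NumberTheory.Weil1964.ArchUnitaryWeilHalfQuotient
import Literature.NumberTheory.Weil1964.ArchFrameDictionaryRealAt
import HarnessLib

/-!
# The archimedean Weil section over a SUB-FAMILY of real places of `F` inert in `E` (place type (i))

Topic `NumberTheory/Weil1964`; namespace `Literature.NumberTheory.Weil1964`.  KERNEL ONLY: definitions with bodies and
theorems; no `def … : Prop` record, no axiom, no proof hole.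

`ArchUnitaryWeilHalf` §3–§4 build Folland's `det^{1/2}`-normalised metaplectic section
`archWeilSectionS : U(J)(F ⊗ ℝ) →* Mp^𝓢(ℝ^{Fin N × {v real}})` over ALL real places of `F` at once, from a global
choice `wOf : {v real} → {w complex}` of `c`-fixed complex places of `E` — which exists only when no real place of
`F` splits in `E`.  For a general quadratic `E/F` the real places of `F` come in two types: (i) `E_v = ℂ` (a
`c`-fixed complex place `w` over `v`) and (ii) `E_v = ℝ × ℝ` (two real places over `v`, `ArchRealSplitPlacesSection`).
This file is the VERBATIM sub-family form of `ArchUnitaryWeilHalf` §3–§4 and `ArchUnitaryWeilHalfQuotient` §2 for the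
type-(i) places: an arbitrary finite index type `o` with `ι₁ : o → {v real}`, `wOf : o → {w complex}`,
`c • w(k) = w(k)` over `ι₁ k` (per-place component `ArchFrameDictionaryRealAt.archUFormAt`):

* §1 per-place sign frames `deltaImAt`, `signVecAt` (`σ_v(t₀ j) = im σ_w(δ) · signOf · D²`, `ht_signVecAt`);
* §2 `archUFormPiSub : U(J)(F ⊗ ℝ) →* Π_k U(P_k, Q_k)`, `archIdxSub : Fin N × o ≃ DPIdx (ΣP) (ΣQ) 1 ∅`,
  **`archWeilSectionSub : U(J)(F ⊗ ℝ) →* Mp^𝓢(ℝ^{Fin N × o})`** (`weilHomV` of `UForm.placeDiag`, relabelled),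
  strongly continuous (`continuous_archWeilSectionSub_apply`), with phase action
  **`coe_proj_archWeilSectionSub`** `= placePhase (k ↦ reindexPhase ε_k (twRealify G_k))`;
* §3 **`quot_archWeilSectionSub : quot (archWeilSectionSub g) = ∏_k (det g_{w(k)})⁻¹`** (Folland's quotient
  character, `UnitaryWeil.quot_weilHomV_unit` + `UForm.det_mat_placeDiag` + `MpS.quot_reindex`);
* §4 `archUFormAt_congr`: transport of `archUFormAt` along an equality of adapted scalings (for frames whose scaling
  at a place is given by a case distinction).

It is the type-(i) block of the three-block archimedean section `(type i) ⊠ (type ii) ⊠ (complex)` of the sequel.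

## References
* [GelbartRogawski1991] S. Gelbart, J. Rogawski, Invent. math. 105 (1991), §3.1 p. 454, Prop. 3.1.1.
* [Weil1964] A. Weil, Acta Math. 111 (1964), Chap. III n° 37–39 pp. 188–190.
* [Paul1998] A. Paul, J. Funct. Anal. 159 (1998), §1.2 (1.2.1)–(1.2.2).
* [KonnoKonno2007] K. Konno, T. Konno, Kyushu J. Math. 61 (2007), §3.1 (3.1).
* [MoeglinVignerasWaldspurger1987] C. Mœglin, M.-F. Vignéras, J.-L. Waldspurger, LNM 1291 (1987), Ch. 1 I.17.
* [Folland1989] G. B. Folland, *Harmonic Analysis in Phase Space*, Princeton UP 1989, §4.2 (4.23), (4.36)–(4.37), Prop. (4.39).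
* [Kudla1994] S. S. Kudla, Israel J. Math. 87 (1994), §3.
-/

set_option autoImplicit false

noncomputable section

open scoped Matrix Real Classical ComplexConjugate Kronecker
open Complex NumberField NumberField.InfinitePlace NumberField.mixedEmbedding IsDedekindDomain
open Literature.NumberTheory.Automorphic Literature.NumberTheory.Automorphic.UnitaryGroup
open Literature.RepresentationTheory.HeisenbergGroup Literature.Analysis.SegalBargmann
open Literature.RepresentationTheory.KonnoKonno2007 Literature.RepresentationTheory.KonnoKonno2007.RealDualPair

namespace Literature.NumberTheory.Weil1964

open MpS UnitaryWeil

/-! ## §1 The canonical sign frame of ONE real place under ONE complex place -/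

section FramesAt

variable {F : Type} [Field F] [NumberField F] {E : Type} [Field E] [NumberField E] [Algebra F E]
  (v : {v : InfinitePlace F // v.IsReal}) (w : {w : InfinitePlace E // w.IsComplex}) {N : ℕ} (t₀ : Fin N → F) (δ : E)

/-- `c_w := im σ_w(δ)`, the scalar of the quadratic coordinate at the complex place `w`. [cite: Folland1989, Ch. 4 §1 Prop. (4.6)] -/
def deltaImAt : ℝ := (w.1.embedding δ).im

/-- the sign vector `x = (σ_v(t₀ j) / c_w)_j` of the real place `v` under `w`. [cite: KonnoKonno2007, §3.1] -/
def signVecAt : Fin N → ℝ := fun j => embedding_of_isReal v.2 (t₀ j) / deltaImAt w δ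

variable {v w t₀ δ}

omit [NumberField F] [NumberField E] in
/-- `c_w ≠ 0`: `σ_w(δ)` is purely imaginary and non-zero. [cite: Folland1989, Ch. 4 §1 Prop. (4.6)] -/
theorem deltaImAt_ne_zero {c : E ≃ₐ[F] E} (hc : c ≠ 1) (hw : c • w.1 = w.1) (hcδ : c δ = -δ) (hδ : δ ≠ 0) :
    deltaImAt w δ ≠ 0 := by
  intro h
  have hre := UnitaryGroup.re_embedding_delta F E c w hw hc hcδ
  have hz : w.1.embedding δ = 0 := Complex.ext hre h
  exact hδ ((map_eq_zero_iff _ w.1.embedding.injective).1 hz)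

omit [NumberField F] [NumberField E] in
/-- `x j ≠ 0` for non-degenerate `t₀`. [cite: KonnoKonno2007, §3.1] -/
theorem signVecAt_ne_zero {c : E ≃ₐ[F] E} (hc : c ≠ 1) (hw : c • w.1 = w.1) (hcδ : c δ = -δ) (hδ : δ ≠ 0)
    (ht0 : ∀ j, t₀ j ≠ 0) (j : Fin N) : signVecAt v w t₀ δ j ≠ 0 :=
  div_ne_zero ((map_ne_zero _).2 (ht0 j)) (deltaImAt_ne_zero hc hw hcδ hδ)

omit [NumberField F] [NumberField E] in
/-- the scaling does not vanish: `√|x j| ≠ 0`. [cite: Folland1989, §1.3 (1.25)] -/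
theorem sqrtAbs_signVecAt_ne_zero {c : E ≃ₐ[F] E} (hc : c ≠ 1) (hw : c • w.1 = w.1) (hcδ : c δ = -δ) (hδ : δ ≠ 0)
    (ht0 : ∀ j, t₀ j ≠ 0) (j : Fin N) : sqrtAbs (signVecAt v w t₀ δ) j ≠ 0 :=
  sqrtAbs_ne_zero (signVecAt_ne_zero hc hw hcδ hδ ht0 j)

omit [NumberField F] [NumberField E] in
/-- **the adapted identity `σ_v(t₀ j) = c_w · signOf(ε j) · D_j²`** in the canonical sign frame `ε = signSplit x`,
`D = √|x|`. [cite: KonnoKonno2007, §3.1; Folland1989, Ch. 4 §1 Prop. (4.6)] -/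
theorem ht_signVecAt {c : E ≃ₐ[F] E} (hc : c ≠ 1) (hw : c • w.1 = w.1) (hcδ : c δ = -δ) (hδ : δ ≠ 0)
    (ht0 : ∀ j, t₀ j ≠ 0) (j : Fin N) :
    embedding_of_isReal v.2 (t₀ j) =
      deltaImAt w δ * signOf (signSplit (signVecAt v w t₀ δ) j) * sqrtAbs (signVecAt v w t₀ δ) j ^ 2 :=
  eq_mul_signOf_signSplit_mul_sqrtAbs_sq (deltaImAt_ne_zero hc hw hcδ hδ) (fun j => embedding_of_isReal v.2 (t₀ j)) j
    ((map_ne_zero _).2 (ht0 j))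

end FramesAt

/-! ## §2 The archimedean section over a sub-family of type-(i) real places -/

section ArchSectionSub

variable {F : Type} [Field F] [NumberField F] (E : Type) [Field E] [NumberField E] [Algebra F E] (c : E ≃ₐ[F] E)
  (N : ℕ) (hc : c ≠ 1) {o : Type} [Fintype o] [DecidableEq o]
  (ι₁ : o → {v : InfinitePlace F // v.IsReal}) (wOf : o → {w : InfinitePlace E // w.IsComplex})
  (hw : ∀ k, c • (wOf k).1 = (wOf k).1) (hover : ∀ k, (wOf k).1.comap (algebraMap F E) = (ι₁ k).1)
  (t₀ : Fin N → F) (ht0 : ∀ j, t₀ j ≠ 0) {T : Matrix (Fin N) (Fin N) F} (hTd : T = Matrix.diagonal t₀)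
  {J : Matrix (Fin N) (Fin N) E} (hJ : J = T.map (algebraMap F E)) {δ : E} (hcδ : c δ = -δ) (hδ : δ ≠ 0)

/-- **the archimedean components in the canonical sign frames over the sub-family**:
`g ↦ (archUFormAt (ι₁ k) (wOf k) (g, 1))_k ∈ Π_k U(P_k, Q_k)`. [cite: MoeglinVignerasWaldspurger1987, Ch. 1 I.17; KonnoKonno2007, §3.1] -/
def archUFormPiSub : UnitaryGroup.arch F E c N J →*
    ∀ k : o, UForm (PosIdx (signVecAt (ι₁ k) (wOf k) t₀ δ)) (NegIdx (signVecAt (ι₁ k) (wOf k) t₀ δ)) :=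
  MonoidHom.pi fun k =>
    (archUFormAt E c N hc (ι₁ k) (wOf k) (hw k) (hover k) t₀ (hJ_diagonal E N t₀ hTd hJ)
      (signSplit (signVecAt (ι₁ k) (wOf k) t₀ δ)) (sqrtAbs_signVecAt_ne_zero hc (hw k) hcδ hδ ht0)
      (deltaImAt_ne_zero hc (hw k) hcδ hδ) (ht_signVecAt hc (hw k) hcδ hδ ht0)).comp (UnitaryGroup.archToAdelic F E c N J)

omit [Fintype o] [DecidableEq o] in
/-- Unfolding. [cite: KonnoKonno2007, §3.1] -/
theorem archUFormPiSub_apply (g : UnitaryGroup.arch F E c N J) (k : o) :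
    archUFormPiSub E c N hc ι₁ wOf hw hover t₀ ht0 hTd hJ hcδ hδ g k =
      archUFormAt E c N hc (ι₁ k) (wOf k) (hw k) (hover k) t₀ (hJ_diagonal E N t₀ hTd hJ)
        (signSplit (signVecAt (ι₁ k) (wOf k) t₀ δ)) (sqrtAbs_signVecAt_ne_zero hc (hw k) hcδ hδ ht0)
        (deltaImAt_ne_zero hc (hw k) hcδ hδ) (ht_signVecAt hc (hw k) hcδ hδ ht0)
        (UnitaryGroup.archToAdelic F E c N J g) := rfl

omit [Fintype o] [DecidableEq o] in
/-- `archUFormPiSub` is continuous. [cite: MoeglinVignerasWaldspurger1987, Ch. 1 I.17] -/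
theorem continuous_archUFormPiSub : Continuous (archUFormPiSub E c N hc ι₁ wOf hw hover t₀ ht0 hTd hJ hcδ hδ) :=
  continuous_pi fun k => (continuous_archUFormAt E c N hc (ι₁ k) (wOf k) (hw k) (hover k) t₀ (hJ_diagonal E N t₀ hTd hJ)
    (signSplit (signVecAt (ι₁ k) (wOf k) t₀ δ)) (sqrtAbs_signVecAt_ne_zero hc (hw k) hcδ hδ ht0)
    (deltaImAt_ne_zero hc (hw k) hcδ hδ) (ht_signVecAt hc (hw k) hcδ hδ ht0)).comp
    (UnitaryGroup.continuous_archToAdelic F E c N J)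

/-- **the coordinates of the type-(i) block of the Folland frame**: `Fin N × o ≃ DPIdx (Σ_k P_k) (Σ_k Q_k) 1 ∅`
(sign-sorted, then the trivial junction). [cite: Weil1964, Chap. III n° 37] -/
def archIdxSub : Fin N × o ≃
    DPIdx (Σ k : o, PosIdx (signVecAt (ι₁ k) (wOf k) t₀ δ)) (Σ k : o, NegIdx (signVecAt (ι₁ k) (wOf k) t₀ δ)) Unit Empty :=
  (placeSumIdx fun k => signSplit (signVecAt (ι₁ k) (wOf k) t₀ δ)).trans (unitJunctionIdx _ _)

omit [NumberField F] [NumberField E] [Algebra F E] [Fintype o] [DecidableEq o] in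
/-- `archIdxSub ∘ unitJunctionIdx⁻¹ = placeSumIdx`. [cite: Weil1964, Chap. III n° 37] -/
theorem archIdxSub_trans_symm :
    (archIdxSub E N ι₁ wOf t₀ (δ := δ)).trans (unitJunctionIdx _ _).symm =
      placeSumIdx fun k => signSplit (signVecAt (ι₁ k) (wOf k) t₀ δ) := by
  rw [archIdxSub, Equiv.trans_assoc, Equiv.self_trans_symm, Equiv.trans_refl]

/-- **`archWeilSectionSub : U(J)(F ⊗ ℝ) →* Mp^𝓢(ℝ^{Fin N × o})`** — Folland's `det^{1/2}`-normalised metaplectic section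
of the block-diagonally assembled components over the sub-family, relabelled to the coordinates of the Folland frame.
[cite: Paul1998, §1.2 (1.2.1); Weil1964, Chap. III n° 37; GelbartRogawski1991, §3.1 p. 454] -/
def archWeilSectionSub : UnitaryGroup.arch F E c N J →* MpS (Fin N × o) :=
  (MpS.reindex (archIdxSub E N ι₁ wOf t₀ (δ := δ))).comp
    ((weilHomV (Σ k : o, PosIdx (signVecAt (ι₁ k) (wOf k) t₀ δ)) (Σ k : o, NegIdx (signVecAt (ι₁ k) (wOf k) t₀ δ))
        Unit Empty).comp
      (UForm.placeDiag.comp (archUFormPiSub E c N hc ι₁ wOf hw hover t₀ ht0 hTd hJ hcδ hδ)))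

/-- Unfolding. [cite: Weil1964, Chap. III n° 37] -/
theorem archWeilSectionSub_apply (g : UnitaryGroup.arch F E c N J) :
    archWeilSectionSub E c N hc ι₁ wOf hw hover t₀ ht0 hTd hJ hcδ hδ g =
      MpS.reindex (archIdxSub E N ι₁ wOf t₀ (δ := δ)) (weilHomV _ _ Unit Empty
        (UForm.placeDiag (archUFormPiSub E c N hc ι₁ wOf hw hover t₀ ht0 hTd hJ hcδ hδ g))) := rfl

/-- **the `𝓢`-orbit maps of `archWeilSectionSub` are continuous.** [cite: Folland1989, §4.2 p. 156; Weil1964, Chap. III n° 39] -/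
theorem continuous_archWeilSectionSub_apply (f : SchwartzMap ((Fin N × o) → ℝ) ℂ) :
    Continuous fun g : UnitaryGroup.arch F E c N J =>
      (archWeilSectionSub E c N hc ι₁ wOf hw hover t₀ ht0 hTd hJ hcδ hδ g).1.2 f := by
  simp only [archWeilSectionSub_apply, MpS.reindex_apply]
  exact (schwartzTransport _).continuous.comp ((continuous_weilHomV_apply _).comp
    (UForm.continuous_placeDiag.comp (continuous_archUFormPiSub E c N hc ι₁ wOf hw hover t₀ ht0 hTd hJ hcδ hδ)))

/-- **the phase action of `archWeilSectionSub g` is the slice-by-slice map** `placePhase (k ↦ reindexPhase ε_k (twRealify G_k))`.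
[cite: KonnoKonno2007, §3.1 (3.1); Weil1964, Chap. I n° 12, Chap. III n° 37] -/
theorem coe_proj_archWeilSectionSub (g : UnitaryGroup.arch F E c N J) :
    (⇑((proj (archWeilSectionSub E c N hc ι₁ wOf hw hover t₀ ht0 hTd hJ hcδ hδ g)).1 :
        ((Fin N × o → ℝ) × (Fin N × o → ℝ)) ≃ₗ[ℝ] ((Fin N × o → ℝ) × (Fin N × o → ℝ))) : PhaseMap (Fin N × o)) =
      placePhase fun k => reindexPhase (signSplit (signVecAt (ι₁ k) (wOf k) t₀ δ))
        (twRealify (((archUFormPiSub E c N hc ι₁ wOf hw hover t₀ ht0 hTd hJ hcδ hδ g k : UForm _ _) :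
          GL (PosIdx (signVecAt (ι₁ k) (wOf k) t₀ δ) ⊕ NegIdx (signVecAt (ι₁ k) (wOf k) t₀ δ)) ℂ) : Matrix _ _ ℂ)) := by
  have h1 : proj (archWeilSectionSub E c N hc ι₁ wOf hw hover t₀ ht0 hTd hJ hcδ hδ g) =
      reindexSp (archIdxSub E N ι₁ wOf t₀ (δ := δ)) (proj (weilHomV _ _ Unit Empty
        (UForm.placeDiag (archUFormPiSub E c N hc ι₁ wOf hw hover t₀ ht0 hTd hJ hcδ hδ g)))) := rfl
  rw [h1, coe_reindexSp, coe_proj_weilHomV_unit, reindexPhase_reindexPhase, archIdxSub_trans_symm, UForm.coe_placeDiag,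
    reindexPhase_twRealify_placeDiagMatrix]

/-! ## §3 The quotient character of the sub-family section -/

omit [Fintype o] [DecidableEq o] in
/-- the determinant of the `k`-component in the sign frame is `det g_{w(k)}`. [cite: KonnoKonno2007, §3.1; Folland1989, §1.3 (1.25)] -/
theorem det_mat_archUFormPiSub (g : UnitaryGroup.arch F E c N J) (k : o) :
    (UnitaryBall.mat (archUFormPiSub E c N hc ι₁ wOf hw hover t₀ ht0 hTd hJ hcδ hδ g k)).det =
      (((archAt F E c N J (wOf k) (hw k) hc g : archLocal E N J (wOf k)) : GL (Fin N) ℂ) : Matrix (Fin N) (Fin N) ℂ).det := by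
  rw [UnitaryBall.mat, archUFormPiSub_apply, coe_archUFormAt, Matrix.reindex_apply, Matrix.det_submatrix_equiv_self,
    det_scaleConj _ (sqrtAbs_signVecAt_ne_zero hc (hw k) hcδ hδ ht0), archPart_archToAdelic]

/-- **THE QUOTIENT CHARACTER OF THE SUB-FAMILY SECTION**: `quot (archWeilSectionSub g) = ∏_k (det g_{w(k)})⁻¹`, the
product over the sub-family of the inverse determinants of the components `g_{w(k)} ∈ U(J_{w(k)})(ℂ)`.
[cite: Folland1989, §4.2 Thm. (4.37); Paul1998, §1.2 (1.2.2); Kudla1994, §3] -/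
theorem quot_archWeilSectionSub (g : UnitaryGroup.arch F E c N J) :
    MpS.quot (archWeilSectionSub E c N hc ι₁ wOf hw hover t₀ ht0 hTd hJ hcδ hδ g) =
      ∏ k : o, ((((archAt F E c N J (wOf k) (hw k) hc g : archLocal E N J (wOf k)) : GL (Fin N) ℂ) :
        Matrix (Fin N) (Fin N) ℂ).det)⁻¹ := by
  have h := UnitaryWeil.quot_weilHomV_unit (α := Σ k : o, PosIdx (signVecAt (ι₁ k) (wOf k) t₀ δ))
    (β := Σ k : o, NegIdx (signVecAt (ι₁ k) (wOf k) t₀ δ))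
    (UForm.placeDiag (archUFormPiSub E c N hc ι₁ wOf hw hover t₀ ht0 hTd hJ hcδ hδ g))
  have h2 : ((UnitaryBall.mat (UForm.placeDiag (archUFormPiSub E c N hc ι₁ wOf hw hover t₀ ht0 hTd hJ hcδ hδ g))).det)⁻¹ =
      ∏ k : o, ((((archAt F E c N J (wOf k) (hw k) hc g : archLocal E N J (wOf k)) : GL (Fin N) ℂ) :
        Matrix (Fin N) (Fin N) ℂ).det)⁻¹ := by
    rw [UForm.det_mat_placeDiag (fun k => signSplit (signVecAt (ι₁ k) (wOf k) t₀ δ)), ← Finset.prod_inv_distrib]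
    exact Finset.prod_congr rfl fun k _ => by rw [det_mat_archUFormPiSub]
  rw [archWeilSectionSub_apply, MpS.quot_reindex, ← h2]
  -- the `Fintype`/`DecidableEq` instance terms of the block index types differ syntactically; `convert` closes them
  convert h using 2

end ArchSectionSub

/-! ## §4 Transport of the per-place component along an equality of scalings -/

section Congr

variable {F : Type} [Field F] [NumberField F] (E : Type) [Field E] [NumberField E] [Algebra F E] (c : E ≃ₐ[F] E)
  (N : ℕ) (hc : c ≠ 1) (v : {v : InfinitePlace F // v.IsReal}) (w : {w : InfinitePlace E // w.IsComplex})
  (hw : c • w.1 = w.1) (hover : w.1.comap (algebraMap F E) = v.1)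
  (t₀ : Fin N → F) {J : Matrix (Fin N) (Fin N) E} (hJ : J = (Matrix.diagonal t₀).map (algebraMap F E))
  {P Q : Type*} [Fintype P] [DecidableEq P] [Fintype Q] [DecidableEq Q] (ε : Fin N ≃ P ⊕ Q)

/-- transport of `archUFormAt` along an equality of adapted scalings. [cite: MoeglinVignerasWaldspurger1987, Chap. 1 I.17] -/
theorem archUFormAt_congr {D D' : Fin N → ℝ} (hDD : D = D') (hD0 : ∀ j, D j ≠ 0) (hD0' : ∀ j, D' j ≠ 0) {c' : ℝ}
    (hc' : c' ≠ 0) (ht : ∀ j, embedding_of_isReal v.2 (t₀ j) = c' * signOf (ε j) * D j ^ 2)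
    (ht' : ∀ j, embedding_of_isReal v.2 (t₀ j) = c' * signOf (ε j) * D' j ^ 2) (u : UnitaryGroup.adelic F E c N J) :
    archUFormAt E c N hc v w hw hover t₀ hJ ε hD0 hc' ht u = archUFormAt E c N hc v w hw hover t₀ hJ ε hD0' hc' ht' u := by
  subst hDD; rfl

end Congr

end Literature.NumberTheory.Weil1964

end
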